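import Literature.Analysis.FluidPDE.SelfSimilarEulerOutgoingExclusion
import HarnessLib

/-!
# In the window `γ < ½` a self-similar Euler profile has a stagnation point with stretching `≥ 1`

Analysis/FluidPDE proofs file (theorems only), sequel of `SelfSimilarEulerOutgoingExclusion.lean`
(CIV 2026 Thm 3.10 without analyticity). The Eulerian weighted `L^{2a}`-vorticity argument there
uses the local outgoing property of Constantin–Ignatova–Vicol (arXiv:2602.17570, Def. 3.7) ONLY
through its linearisation `⟪DU(z) w, w⟫ ≤ 2(γ − c_*)|w|²` at each stagnation point `z` of
`V = γ(y − c) + U` — not through the finiteness of the stagnation set or the sign of `V·(y − z)`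
off the node — and the far field (3.8) only through eventual outward radial transport. Hence:

> **Theorem** (`IsSelfSimilarEulerProfile.eq_zero_of_stagnation_stretching_lt_one`). Let
> `0 < γ < ½` and let `(U, P)` be a `C²` stationary self-similar Euler profile (CIV (3.3), centre
> `c`) with the far-field bounds (3.8). If at EVERY stagnation point `z` of `V` (`V(z) = 0`) the
> stretching rates are below one, `⟪DU(z) w, w⟫ < |w|²` for all `w ≠ 0` (all eigenvalues of the
> strain `𝕊(z) = ½(DU + DUᵀ)(z)` are `< 1`), then `U ≡ 0`.

Equivalently (`exists_stagnation_stretching_ge_one`): **a nontrivial profile in the window has a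
stagnation point of its self-similar Lagrangian flow at which the strain has an eigenvalue `≥ 1`**
(compare CIV Prop. 3.3, tree `stretching_eq_one_of_isMaxOn`: stretching EQUALS one at the maximum
of `|Ω|`; CIV Thm 3.8: at a VORTICAL node `Ω(z)` is an eigenvector of `𝕊(z)` with eigenvalue `1`;
Thm 3.10 = the case where the outgoing property puts the spectrum of `𝕊(z)` in `[c_*−γ, 2(γ−c_*)]`).

* `HasSelfSimilarFarFieldWith.exists_inner_transport_ge`, `selfSimilarNodalSet_subset_closedBall`,
  `isCompact_selfSimilarNodalSet` — under (3.8) (`γ > 0`), `⟪V(y), y − c⟫ ≥ (γ/2)|y − c|²` far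
  out, so the stagnation set is bounded and compact;
* `IsSelfSimilarEulerProfile.curl_eq_zero_of_stagnation_stretching_le_of_outward` — the core with
  a uniform node bound `⟪DU(z) w, w⟫ ≤ θ₀|w|²`, `θ₀ < 1`, and NO decay hypothesis beyond eventual
  outward radial transport `⟪V(y), y − c⟫ ≥ 0` (`|y − c| ≥ R₀`); `…_le` — the same under (3.8);
* `IsSelfSimilarEulerProfile.eq_zero_of_stagnation_stretching_lt_one` — pointwise hypothesis
  `< |w|²`, made uniform by compactness of (stagnation set) × (unit sphere);
  `exists_stagnation_stretching_ge_one` and the exponent form `…_of_exponent`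
  (route EulerZoomLiouville: `γ = 1/(2+ρ)`, `ρ > 0`).

WHAT THIS IS NOT: stagnation points with an eigenvalue `≥ 1` of the strain (e.g. CIV's vortical
nodes with an inflow sector) are NOT excluded by this method — at such a point the weight's
transport derivative vanishes and the local bracket `2a(σ − 1) + 3γ` is positive.

## References

* P. Constantin, M. Ignatova, V. Vicol, arXiv:2602.17570 (2026), §3.2 Prop. 3.3, §3.5 Def. 3.7,
  Thm. 3.8, Thm. 3.10. [ConstantinIgnatovaVicol2026Putative]
-/

noncomputable section

open MeasureTheory Set Filter Function Topology InnerProductSpace Metric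
open scoped RealInnerProductSpace NNReal

namespace Literature.Analysis.FluidPDE

/-! ### The stagnation set is compact under the far-field bounds -/

namespace HasSelfSimilarFarFieldWith

variable {γ C : ℝ} {c : EuclideanSpace ℝ (Fin 3)}
  {U : EuclideanSpace ℝ (Fin 3) → EuclideanSpace ℝ (Fin 3)}

/-- **Strict outflow far out**: under (3.8) with `γ > 0` there is `R > 0` with
`⟪γ(y − c) + U(y), y − c⟫ ≥ (γ/2)|y − c|²` for `|y − c| ≥ R` (CIV §3.5: "`V(y)·y ≥ (γ/2)|y|²`
for `|y| ≥ R♭`"). [cite: ConstantinIgnatovaVicol2026Putative, §3.5 (the radius R♭, display before Def. 3.7)] -/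
theorem exists_inner_transport_ge (hγ : 0 < γ) (h : HasSelfSimilarFarFieldWith γ c C U) :
    ∃ R : ℝ, 0 < R ∧ ∀ y, R ≤ ‖y - c‖ →
      γ / 2 * ‖y - c‖ ^ 2 ≤ ⟪selfSimilarTransport γ c U y, y - c⟫ := by
  have hγ2 : 0 < γ / 2 := half_pos hγ
  have hev : ∀ᶠ t in atTop, C * (1 + t ^ 2) ^ (-(1 / (2 * γ))) ≤ γ / 2 :=
    (tendsto_decayFactor hγ C) (Iic_mem_nhds hγ2)
  obtain ⟨R₀, hR₀⟩ := Filter.eventually_atTop.1 hev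
  refine ⟨max R₀ 1, lt_max_of_lt_right one_pos, fun y hy => ?_⟩
  have hyR₀ : R₀ ≤ ‖y - c‖ := (le_max_left _ _).trans hy
  have hdec := hR₀ _ hyR₀
  have hUy := (h y).1
  rw [selfSimilarTransport_apply, inner_add_left, inner_smul_left]
  simp only [conj_trivial, real_inner_self_eq_norm_sq]
  have h1 : |⟪U y, y - c⟫| ≤ ‖U y‖ * ‖y - c‖ := abs_real_inner_le_norm _ _
  have h2 : ‖U y‖ * ‖y - c‖ ≤ γ / 2 * ‖y - c‖ ^ 2 := by
    have hr : 0 ≤ ‖y - c‖ := norm_nonneg _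
    calc ‖U y‖ * ‖y - c‖
        ≤ C * ‖y - c‖ * (1 + ‖y - c‖ ^ 2) ^ (-(1 / (2 * γ))) * ‖y - c‖ :=
          mul_le_mul_of_nonneg_right hUy hr
      _ = C * (1 + ‖y - c‖ ^ 2) ^ (-(1 / (2 * γ))) * ‖y - c‖ ^ 2 := by ring
      _ ≤ γ / 2 * ‖y - c‖ ^ 2 := mul_le_mul_of_nonneg_right hdec (sq_nonneg _)
  have := (abs_le.1 h1).1
  linarith

/-- **The stagnation set is bounded**: under (3.8) with `γ > 0`, `𝒩_V ⊆ B̄(c, R)` for the radius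
of `exists_inner_transport_ge` (CIV §3.5: "all the zeros of `V` lie in the interior of …").
[cite: ConstantinIgnatovaVicol2026Putative, §3.5 proof of Thm. 3.10] -/
theorem selfSimilarNodalSet_subset_closedBall (hγ : 0 < γ) (h : HasSelfSimilarFarFieldWith γ c C U) :
    ∃ R : ℝ, 0 < R ∧ selfSimilarNodalSet γ c U ⊆ closedBall c R := by
  obtain ⟨R, hR, hout⟩ := h.exists_inner_transport_ge hγ
  refine ⟨R, hR, fun z hz => ?_⟩
  rw [mem_closedBall, dist_eq_norm]
  by_contra hlt
  have hRz : R ≤ ‖z - c‖ := (not_le.1 hlt).le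
  have h1 := hout z hRz
  have hV0 : selfSimilarTransport γ c U z = 0 := hz
  rw [hV0, inner_zero_left] at h1
  have hpos : 0 < γ / 2 * ‖z - c‖ ^ 2 := by
    have : 0 < ‖z - c‖ := hR.trans_le hRz
    positivity
  linarith

/-- **The stagnation set is compact** under (3.8) with `γ > 0` (closed, as the zero set of the
continuous field `V`, and bounded) — for a `C²` (indeed continuous) profile. [cite: ConstantinIgnatovaVicol2026Putative, §3.5 proof of Thm. 3.10] -/
theorem isCompact_selfSimilarNodalSet (hγ : 0 < γ) (h : HasSelfSimilarFarFieldWith γ c C U)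
    (hU : Continuous U) : IsCompact (selfSimilarNodalSet γ c U) := by
  obtain ⟨R, _, hsub⟩ := h.selfSimilarNodalSet_subset_closedBall hγ
  have hVc : Continuous (selfSimilarTransport γ c U) := by
    have : Continuous fun y : EuclideanSpace ℝ (Fin 3) => γ • (y - c) + U y :=
      ((continuous_id.sub continuous_const).const_smul γ).add hU
    exact this
  have hcl : IsClosed (selfSimilarNodalSet γ c U) := isClosed_singleton.preimage hVc
  exact (isCompact_closedBall c R).of_isClosed_subset hcl hsub

end HasSelfSimilarFarFieldWith

/-! ### Stretching below one at every stagnation point forces `Ω ≡ 0` -/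

namespace IsSelfSimilarEulerProfile

variable {γ : ℝ} {c : EuclideanSpace ℝ (Fin 3)}
  {U : EuclideanSpace ℝ (Fin 3) → EuclideanSpace ℝ (Fin 3)} {P : EuclideanSpace ℝ (Fin 3) → ℝ}

/-- **Core, uniform form, WITHOUT the far-field bounds.** Let `0 < γ < ½` and `(U, P)` a `C²`
profile (CIV (3.3)). Suppose `⟪DU(z) w, w⟫ ≤ θ₀|w|²` with one `θ₀ < 1` for every stagnation point
`z` of `V = γ(y−c) + U` and every `w`, and suppose ONLY that the radial transport is eventually
outward: `⟪V(y), y − c⟫ ≥ 0` for `|y − c| ≥ R₀` (no decay of `U`, `DU` or `Ω` is assumed). Then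
`curl U = 0`. (Weighted `L^{2a}` identity `curl_eq_zero_of_weight` with the Bernoulli weight — the
far field (3.8) enters the argument of `curl_eq_zero_of_isLocallyOutgoing_of_lt_half` only through
this outward sign.) [cite: ConstantinIgnatovaVicol2026Putative, §3.5 Thm. 3.10 (proof, sharpened)] -/
theorem curl_eq_zero_of_stagnation_stretching_le_of_outward (h : IsSelfSimilarEulerProfile γ c U P)
    (hγ : 0 < γ) (hγ2 : γ < 1 / 2) {θ₀ : ℝ} (hθ₀ : θ₀ < 1)
    (hnode : ∀ z ∈ selfSimilarNodalSet γ c U, ∀ w : EuclideanSpace ℝ (Fin 3),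
      ⟪fderiv ℝ U z w, w⟫ ≤ θ₀ * ‖w‖ ^ 2)
    {R₀ : ℝ} (hR₀ : 0 < R₀)
    (hfarout : ∀ y, R₀ ≤ ‖y - c‖ → 0 ≤ ⟪selfSimilarTransport γ c U y, y - c⟫) :
    curl U = 0 := by
  classical
  have hU2 : ContDiff ℝ 2 U := h.contDiff_velocity
  have hUd : Differentiable ℝ U := hU2.differentiable (by norm_num)
  have hDUc : Continuous (fderiv ℝ U) := hU2.continuous_fderiv (by norm_num)
  have hVp := h.isSelfSimilarEulerVorticityProfile
  set V : EuclideanSpace ℝ (Fin 3) → EuclideanSpace ℝ (Fin 3) := selfSimilarTransport γ c U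
    with hVdef
  have hVc : Continuous V := by
    have : Continuous fun y : EuclideanSpace ℝ (Fin 3) => γ • (y - c) + U y :=
      ((continuous_id.sub continuous_const).const_smul γ).add hU2.continuous
    exact this
  set N : Set (EuclideanSpace ℝ (Fin 3)) := selfSimilarNodalSet γ c U with hNdef
  -- (1) a neighbourhood `D` of the nodal set where `⟪DU w, w⟫ ≤ θ|w|²`, `θ = (1+θ₀)/2 < 1`
  set θ : ℝ := (1 + θ₀) / 2 with hθdef
  have hθ1 : θ < 1 := by rw [hθdef]; linarith
  have hrad : ∀ z ∈ N, ∃ r : ℝ, 0 < r ∧ ∀ y, dist y z < r →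
      ∀ w : EuclideanSpace ℝ (Fin 3), ⟪fderiv ℝ U y w, w⟫ ≤ θ * ‖w‖ ^ 2 := by
    intro z hz
    have hδ : 0 < (1 - θ₀) / 2 := by linarith
    obtain ⟨r, hr, hball⟩ := Metric.continuousAt_iff.1 (hDUc.continuousAt (x := z)) _ hδ
    refine ⟨r, hr, fun y hy w => ?_⟩
    have hn : ‖fderiv ℝ U y - fderiv ℝ U z‖ < (1 - θ₀) / 2 := by
      rw [← dist_eq_norm]; exact hball hy
    have h1 : ⟪(fderiv ℝ U y - fderiv ℝ U z) w, w⟫ ≤ (1 - θ₀) / 2 * ‖w‖ ^ 2 := by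
      calc ⟪(fderiv ℝ U y - fderiv ℝ U z) w, w⟫
          ≤ ‖(fderiv ℝ U y - fderiv ℝ U z) w‖ * ‖w‖ := real_inner_le_norm _ _
        _ ≤ ‖fderiv ℝ U y - fderiv ℝ U z‖ * ‖w‖ * ‖w‖ :=
            mul_le_mul_of_nonneg_right (ContinuousLinearMap.le_opNorm _ _) (norm_nonneg _)
        _ ≤ (1 - θ₀) / 2 * ‖w‖ * ‖w‖ := by gcongr
        _ = (1 - θ₀) / 2 * ‖w‖ ^ 2 := by ring
    have h2 := hnode z hz w
    have e : ⟪fderiv ℝ U y w, w⟫ = ⟪fderiv ℝ U z w, w⟫ + ⟪(fderiv ℝ U y - fderiv ℝ U z) w, w⟫ := by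
      rw [show (fderiv ℝ U y - fderiv ℝ U z) w = fderiv ℝ U y w - fderiv ℝ U z w from rfl,
        inner_sub_left]
      ring
    rw [e, hθdef]
    linarith
  choose! r hr hrD using hrad
  set D : Set (EuclideanSpace ℝ (Fin 3)) := ⋃ z ∈ N, ball z (r z) with hDdef
  have hDo : IsOpen D := isOpen_biUnion fun z _ => isOpen_ball
  have hND : N ⊆ D := fun z hz => mem_biUnion hz (mem_ball_self (hr z hz))
  have hDθ : ∀ y ∈ D, ∀ w : EuclideanSpace ℝ (Fin 3), ⟪fderiv ℝ U y w, w⟫ ≤ θ * ‖w‖ ^ 2 := by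
    intro y hy w
    obtain ⟨z, hz, hyz⟩ := mem_iUnion₂.1 hy
    exact hrD z hz y (mem_ball.1 hyz) w
  set a : ℝ := 1 + (3 * γ + 1) / (2 * (1 - θ)) with hadef
  have ha1 : 1 ≤ a := by
    rw [hadef]
    have : 0 ≤ (3 * γ + 1) / (2 * (1 - θ)) := by
      apply div_nonneg <;> linarith
    linarith
  have haθ : 2 * a * (θ - 1) + 3 * γ ≤ -1 := by
    have h1θ : 0 < 1 - θ := by linarith
    have hne : 2 * (1 - θ) ≠ 0 := by positivity
    have e : 2 * a * (1 - θ) = 2 * (1 - θ) + (3 * γ + 1) := by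
      calc 2 * a * (1 - θ) = 2 * (1 - θ) + (3 * γ + 1) / (2 * (1 - θ)) * (2 * (1 - θ)) := by
            rw [hadef]; ring
        _ = 2 * (1 - θ) + (3 * γ + 1) := by rw [div_mul_cancel₀ _ hne]
    nlinarith
  -- (4) for every radius `R ≥ R₀`, `Ω = 0` on `B̄(c, R)`
  have hball : ∀ R, R₀ ≤ R → ∀ y, ‖y - c‖ ≤ R → curl U y = 0 := by
    intro R hRR
    have hR : 0 < R := hR₀.trans_le hRR
    set K : Set (EuclideanSpace ℝ (Fin 3)) := closedBall c (2 * R) ∩ Dᶜ with hKdef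
    have hKc : IsCompact K := (isCompact_closedBall c (2 * R)).inter_right hDo.isClosed_compl
    have hVpos : ∀ y ∈ K, 0 < ‖V y‖ := by
      intro y hy
      rw [norm_pos_iff]
      intro hV0
      have hyN : y ∈ N := hV0
      exact hy.2 (hND hyN)
    obtain ⟨cfl, hcfl, hcflle⟩ := hKc.exists_forall_le' hVc.norm.continuousOn hVpos
    obtain ⟨M₀, hM₀⟩ := (isCompact_closedBall c (2 * R)).exists_bound_of_continuousOn
      hDUc.continuousOn
    set M : ℝ := max M₀ 1 with hMdef
    have hM : ∀ y, ‖y - c‖ ≤ 2 * R → ‖fderiv ℝ U y‖ ≤ M := fun y hy =>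
      (hM₀ y (by rw [mem_closedBall, dist_eq_norm]; exact hy)).trans (le_max_left _ _)
    set lam : ℝ := (2 * a * M + 3 * γ + 1) / ((1 - 2 * γ) * cfl ^ 2) with hlamdef
    have hlam0 : 0 ≤ lam := by
      rw [hlamdef]
      apply div_nonneg
      · have : 0 ≤ 2 * a * M := by positivity
        linarith
      · have : 0 < 1 - 2 * γ := by linarith
        positivity
    have hlamK : 2 * a * (M - 1) + lam * ((2 * γ - 1) * cfl ^ 2) + 3 * γ ≤ -1 := by
      have hpos : 0 < (1 - 2 * γ) * cfl ^ 2 := by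
        have : 0 < 1 - 2 * γ := by linarith
        positivity
      have e : lam * ((2 * γ - 1) * cfl ^ 2) = -(2 * a * M + 3 * γ + 1) := by
        calc lam * ((2 * γ - 1) * cfl ^ 2)
            = -((2 * a * M + 3 * γ + 1) / ((1 - 2 * γ) * cfl ^ 2) * ((1 - 2 * γ) * cfl ^ 2)) := by
              rw [hlamdef]; ring
          _ = -(2 * a * M + 3 * γ + 1) := by rw [div_mul_cancel₀ _ hpos.ne']
      rw [e]
      have : 0 ≤ 2 * a := by linarith
      nlinarith
    set ψ : EuclideanSpace ℝ (Fin 3) → ℝ := fun y => lam * selfSimilarBernoulli γ c U P y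
      with hψdef
    have hH1 := h.contDiff_selfSimilarBernoulli
    have hψ1 : ContDiff ℝ 1 ψ := contDiff_const.mul hH1
    have hψV : ∀ y, fderiv ℝ ψ y (V y) = lam * ((2 * γ - 1) * ‖V y‖ ^ 2) := by
      intro y
      have hHd : DifferentiableAt ℝ (selfSimilarBernoulli γ c U P) y :=
        hH1.differentiable one_ne_zero y
      rw [hψdef, fderiv_const_mul hHd, _root_.smul_apply, smul_eq_mul, hVdef,
        h.fderiv_selfSimilarBernoulli_transport y]
    set m : EuclideanSpace ℝ (Fin 3) → ℝ := fun y => if y ∈ D then θ else M with hmdef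
    have hm : ∀ y, ‖y - c‖ ≤ 2 * R →
        ⟪curl U y, fderiv ℝ U y (curl U y)⟫ ≤ m y * ‖curl U y‖ ^ 2 := by
      intro y hy
      by_cases hyD : y ∈ D
      · have hmy : m y = θ := if_pos hyD
        rw [hmy, real_inner_comm]
        exact hDθ y hyD _
      · have hmy : m y = M := if_neg hyD
        rw [hmy]
        calc ⟪curl U y, fderiv ℝ U y (curl U y)⟫
            ≤ ‖curl U y‖ * ‖fderiv ℝ U y (curl U y)‖ := real_inner_le_norm _ _
          _ ≤ ‖curl U y‖ * (‖fderiv ℝ U y‖ * ‖curl U y‖) :=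
              mul_le_mul_of_nonneg_left (ContinuousLinearMap.le_opNorm _ _) (norm_nonneg _)
          _ ≤ ‖curl U y‖ * (M * ‖curl U y‖) := by gcongr; exact hM y hy
          _ = M * ‖curl U y‖ ^ 2 := by ring
    have hbr : ∀ y, ‖y - c‖ ≤ 2 * R →
        2 * a * (m y - 1) + fderiv ℝ ψ y (selfSimilarTransport γ c U y) + 3 * γ ≤ -1 := by
      intro y hy
      rw [← hVdef, hψV y]
      by_cases hyD : y ∈ D
      · have hmy : m y = θ := if_pos hyD
        rw [hmy]
        have hneg : lam * ((2 * γ - 1) * ‖V y‖ ^ 2) ≤ 0 := by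
          have : (2 * γ - 1) * ‖V y‖ ^ 2 ≤ 0 :=
            mul_nonpos_of_nonpos_of_nonneg (by linarith) (sq_nonneg _)
          exact mul_nonpos_of_nonneg_of_nonpos hlam0 this
        linarith
      · have hmy : m y = M := if_neg hyD
        rw [hmy]
        have hyK : y ∈ K := ⟨by rw [mem_closedBall, dist_eq_norm]; exact hy, hyD⟩
        have hVy : cfl ≤ ‖V y‖ := hcflle y hyK
        have hsq : cfl ^ 2 ≤ ‖V y‖ ^ 2 := pow_le_pow_left₀ hcfl.le hVy 2
        have hmono : lam * ((2 * γ - 1) * ‖V y‖ ^ 2) ≤ lam * ((2 * γ - 1) * cfl ^ 2) := by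
          apply mul_le_mul_of_nonneg_left _ hlam0
          have : 2 * γ - 1 ≤ 0 := by linarith
          exact mul_le_mul_of_nonpos_left hsq this
        linarith
    have hout' : ∀ y, R ≤ ‖y - c‖ → 0 ≤ ⟪selfSimilarTransport γ c U y, y - c⟫ :=
      fun y hy => hfarout y (hRR.trans hy)
    exact hVp.curl_eq_zero_of_weight ha1 hψ1 hR hm hbr hout'
  funext y
  have := hball (max R₀ ‖y - c‖) (le_max_left _ _) y (le_max_right _ _)
  simpa using this

/-- **Core, uniform form.** Let `0 < γ < ½`, `(U, P)` a `C²` profile (CIV (3.3)) with the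
far-field bounds (3.8), and suppose `⟪DU(z) w, w⟫ ≤ θ₀|w|²` with one `θ₀ < 1` for every stagnation
point `z` of `V = γ(y−c) + U` and every `w`. Then `curl U = 0` ((3.8) makes the radial transport
eventually outward, `HasSelfSimilarFarFieldWith.exists_inner_transport_nonneg`). [cite: ConstantinIgnatovaVicol2026Putative, §3.5 Thm. 3.10 (proof, sharpened)] -/
theorem curl_eq_zero_of_stagnation_stretching_le (h : IsSelfSimilarEulerProfile γ c U P)
    (hγ : 0 < γ) (hγ2 : γ < 1 / 2) {C : ℝ} (hfar : HasSelfSimilarFarFieldWith γ c C U)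
    {θ₀ : ℝ} (hθ₀ : θ₀ < 1)
    (hnode : ∀ z ∈ selfSimilarNodalSet γ c U, ∀ w : EuclideanSpace ℝ (Fin 3),
      ⟪fderiv ℝ U z w, w⟫ ≤ θ₀ * ‖w‖ ^ 2) : curl U = 0 := by
  obtain ⟨R₀, hR₀, hfarout⟩ := hfar.exists_inner_transport_nonneg hγ
  exact h.curl_eq_zero_of_stagnation_stretching_le_of_outward hγ hγ2 hθ₀ hnode hR₀ hfarout

/-- **Core, pointwise form.** Let `0 < γ < ½`, `(U, P)` a `C²` profile (CIV (3.3)) with the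
far-field bounds (3.8). If `⟪DU(z) w, w⟫ < |w|²` for every stagnation point `z` of
`V = γ(y−c) + U` and every `w ≠ 0` (all eigenvalues of the strain at `z` are `< 1`), then `U = 0`.
The stagnation set is compact (`isCompact_selfSimilarNodalSet`), so the continuous function
`(z, w) ↦ ⟪DU(z) w, w⟫` on (stagnation set) × (unit sphere) stays below some `θ₀ < 1`; then
`curl U = 0` by the uniform form, and `U` is constant `= U(c) = 0` by the harmonic Liouville step.
[cite: ConstantinIgnatovaVicol2026Putative, §3.5 Thm. 3.10 (proof, sharpened)] -/
theorem eq_zero_of_stagnation_stretching_lt_one (h : IsSelfSimilarEulerProfile γ c U P)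
    (hγ : 0 < γ) (hγ2 : γ < 1 / 2) (hfar : HasSelfSimilarFarField γ c U)
    (hnode : ∀ z ∈ selfSimilarNodalSet γ c U, ∀ w : EuclideanSpace ℝ (Fin 3), w ≠ 0 →
      ⟪fderiv ℝ U z w, w⟫ < ‖w‖ ^ 2) : U = 0 := by
  obtain ⟨C, hC⟩ := hfar
  have hU2 : ContDiff ℝ 2 U := h.contDiff_velocity
  have hDUc : Continuous (fderiv ℝ U) := hU2.continuous_fderiv (by norm_num)
  set N : Set (EuclideanSpace ℝ (Fin 3)) := selfSimilarNodalSet γ c U with hNdef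
  have hNc : IsCompact N := hC.isCompact_selfSimilarNodalSet hγ hU2.continuous
  set S : Set (EuclideanSpace ℝ (Fin 3)) := sphere 0 1 with hSdef
  have hSc : IsCompact S := isCompact_sphere 0 1
  set F : EuclideanSpace ℝ (Fin 3) × EuclideanSpace ℝ (Fin 3) → ℝ :=
    fun p => 1 - ⟪fderiv ℝ U p.1 p.2, p.2⟫ with hFdef
  have hFc : Continuous F := by
    have h1 : Continuous fun p : EuclideanSpace ℝ (Fin 3) × EuclideanSpace ℝ (Fin 3) =>
        fderiv ℝ U p.1 p.2 :=
      (hDUc.comp continuous_fst).clm_apply continuous_snd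
    exact continuous_const.sub (h1.inner continuous_snd)
  have hFpos : ∀ p ∈ N ×ˢ S, (0 : ℝ) < F p := by
    rintro ⟨z, w⟩ ⟨hz, hw⟩
    have hw1 : ‖w‖ = 1 := by simpa [hSdef] using hw
    have hw0 : w ≠ 0 := by
      rw [← norm_ne_zero_iff, hw1]; exact one_ne_zero
    have := hnode z hz w hw0
    rw [hw1, one_pow] at this
    simp only [hFdef]
    linarith
  obtain ⟨a', ha', hle⟩ := (hNc.prod hSc).exists_forall_le' hFc.continuousOn hFpos
  have hθ₀ : 1 - a' < 1 := by linarith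
  have hnode' : ∀ z ∈ N, ∀ w : EuclideanSpace ℝ (Fin 3),
      ⟪fderiv ℝ U z w, w⟫ ≤ (1 - a') * ‖w‖ ^ 2 := by
    intro z hz w
    by_cases hw : w = 0
    · simp [hw]
    have hn : ‖w‖ ≠ 0 := norm_ne_zero_iff.2 hw
    set e : EuclideanSpace ℝ (Fin 3) := ‖w‖⁻¹ • w with he
    have he1 : ‖e‖ = 1 := by rw [he, norm_smul, norm_inv, norm_norm, inv_mul_cancel₀ hn]
    have heS : e ∈ S := by simpa [hSdef] using he1
    have h1 := hle (z, e) ⟨hz, heS⟩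
    simp only [hFdef] at h1
    have hwe : w = ‖w‖ • e := by rw [he, smul_smul, mul_inv_cancel₀ hn, one_smul]
    have h2 : ⟪fderiv ℝ U z w, w⟫ = ‖w‖ ^ 2 * ⟪fderiv ℝ U z e, e⟫ := by
      rw [hwe, map_smul, inner_smul_left, inner_smul_right, conj_trivial, norm_smul, norm_norm,
        he1, mul_one]
      ring
    rw [h2]
    nlinarith [sq_nonneg ‖w‖]
  have hcurl0 := h.curl_eq_zero_of_stagnation_stretching_le hγ hγ2 hC hθ₀ hnode'
  have hcurl : ∀ x, curl U x = 0 := fun x => congrFun hcurl0 x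
  have hD := hC.tendsto_norm_fderiv hγ
  funext y
  rw [eq_of_curl_eq_zero_of_isDivFree_of_fderiv_tendsto_zero hU2 hcurl h.divFree hD y c,
    hC.apply_center]
  rfl

/-- **A nontrivial profile in the window has a stagnation point with stretching rate `≥ 1`.**
Let `0 < γ < ½` and let `(U, P)` be a NONTRIVIAL `C²` self-similar Euler profile with the far-field
bounds (3.8). Then there are a stagnation point `z` of `V = γ(y−c) + U` and a direction `w ≠ 0` with
`⟪DU(z) w, w⟫ ≥ |w|²` — the strain at `z` has an eigenvalue `≥ 1`. (Contrapositive of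
`eq_zero_of_stagnation_stretching_lt_one`; compare CIV Prop. 3.3 / Thm. 3.8.) [cite: ConstantinIgnatovaVicol2026Putative, §3.5 Thm. 3.10 (proof, sharpened)] -/
theorem exists_stagnation_stretching_ge_one (h : IsSelfSimilarEulerProfile γ c U P)
    (hγ : 0 < γ) (hγ2 : γ < 1 / 2) (hfar : HasSelfSimilarFarField γ c U) (hU : U ≠ 0) :
    ∃ z ∈ selfSimilarNodalSet γ c U, ∃ w : EuclideanSpace ℝ (Fin 3), w ≠ 0 ∧
      ‖w‖ ^ 2 ≤ ⟪fderiv ℝ U z w, w⟫ := by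
  by_contra hcon
  push Not at hcon
  exact hU (h.eq_zero_of_stagnation_stretching_lt_one hγ hγ2 hfar
    fun z hz w hw => hcon z hz w hw)

/-- **Exponent form** (route EulerZoomLiouville: `γ = 1/(2+ρ)`, window `ρ > 0 ⟺ 0 < γ < ½`): a
classical self-similar Euler profile with the class exponent and the decay (3.8) whose strain has all
eigenvalues `< 1` at every stagnation point of the self-similar transport field is trivial.
[cite: ConstantinIgnatovaVicol2026Putative, §3.5 Thm. 3.10 (proof, sharpened)] -/
theorem eq_zero_of_stagnation_stretching_lt_one_of_exponent (h : IsSelfSimilarEulerProfile γ c U P)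
    {ρ : ℝ} (hρ : 0 < ρ) (hγ : γ = 1 / (2 + ρ)) (hfar : HasSelfSimilarFarField γ c U)
    (hnode : ∀ z ∈ selfSimilarNodalSet γ c U, ∀ w : EuclideanSpace ℝ (Fin 3), w ≠ 0 →
      ⟪fderiv ℝ U z w, w⟫ < ‖w‖ ^ 2) : U = 0 := by
  have h2ρ : (0 : ℝ) < 2 + ρ := by linarith
  refine h.eq_zero_of_stagnation_stretching_lt_one (hγ ▸ one_div_pos.2 h2ρ) ?_ hfar hnode
  rw [hγ]
  exact one_div_lt_one_div_of_lt two_pos (by linarith)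

end IsSelfSimilarEulerProfile

end Literature.Analysis.FluidPDE

end
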